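import Summits.CriticalPhenomena.PercolationContinuityZ3.Theorems.PercNearOneGluingNoHeavyRsw3SetToSetHardCrossingEngine
import Summits.CriticalPhenomena.PercolationContinuityZ3.Theorems.PercNearOneGluingNoHeavyRsw3CrossingBridges
import Summits.CriticalPhenomena.PercolationContinuityZ3.Theorems.PercNearOneGluingNoHeavyRsw3AnnulusAspectWindow
import Summits.CriticalPhenomena.PercolationContinuityZ3.Theorems.PercAnnulusCrossingBoxCrossingLength
import Summits.CriticalPhenomena.PercolationContinuityZ3.Theorems.PercAnnulusCrossingBoxCrossingDefs2
import HarnessLib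

/-!
# RSW3 lane (P2, gen 16): BASU–SAPOZHNIKOV'S (A2)□ AT `p_c(ℤ³)` IMPLIES THE LOWER HALF OF 3-D RSW WITH GEOMETRIC
# CONSTANTS — `SetToSetQuasiMultAspectAt 3 p_c s L ϰ → GeometricHardCrossingLowerBound`

builds on p205010 (kernel theorem, internal audit signed; external expert review pending) — NOT used in this file
(the inputs at `p_c` are the annulus window and the easy-crossing bounds of Kesten type, which do not need `θ(p_c) = 0`).

Cell `prim-rsw3`, prover seat `prim-rsw3-p2` (gen 16), memo `run/shared/lean/prim/rsw3/P2-RSWLITE.md` §23.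
Support file (`--supports stmt-CriticalPhenomena-4575`); no definitions, no named facts, no sorries.

THE THEOREM.  A new edge of the lane diagram: the single open input of the printed incipient-infinite-cluster construction for
`ℤ³` (Basu–Sapozhnikov 2017, assumption (A2), lane box form `Crossing.SetToSetQuasiMultAspectAt 3 p_c s L ϰ`, any aspect
`2 ≤ s ≤ L`; the printed one is `(2,4)`) IMPLIES the lower half of the 3-D Russo–Seymour–Welsh box-crossing property with
constants geometric in the aspect ratio:

* `geometricHardCrossingLowerBound_of_setToSetQuasiMultAspectAt` — `∃ c > 0 ∀ K n ≥ 1, c^K ≤ P_{p_c}(boxCross (hardShape K n) 0)`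
  (`Crossing.GeometricHardCrossingLowerBound`, the typed OPEN obligation node of `…BoxCrossingDefs2`, ⟺ bounded `n·μ_{p_c}(n)` for the
  tube correlation length by the lead's `rate_bounded_iff_exp_hardCrossing`);
* hence `hardCrossingLowerBound_of_setToSetQuasiMultAspectAt` (`HardCrossingLowerBound k` for every `k ≥ 1`),
  `crossingLowerBound_cubeShape_of_setToSetQuasiMultAspectAt` (the cube, lower half of `CubeCrossingNondegenerate`), and the
  printed-aspect forms `…_of_setToSetQuasiMult` (hypothesis `Crossing.SetToSetQuasiMult`).

So (A2)□ at `p_c(ℤ³)` is at least as strong as (S1-lo) at every aspect; the converse is not claimed (above six dimensions hard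
crossings hold while (A2) fails).  LANE4-READINESS (17) recorded "neither implies the other in the tree"; this file supplies one
direction.  The every-`p` engine is `pow_mul_div_le_real_boxCross_of_setToSetQuasiMultAspectAt` (file `…Rsw3SetToSetHardCrossingEngine`,
built on the chain `…Rsw3SetToSetHardCrossingChain` and the column geometry `…Rsw3SetToSetHardCrossingPatches`):

  `(ϰ·u)^(K+1) · e / (t+1)² ≤ P_p(boxCross ![N, W, W] 0)`,

`u = P_p(Λ(m) ↔ ∂ⁱⁿΛ(sm) in Λ(sm))`, `e = P_p(boxCross ![(L-s)m+1, ℓ, ℓ] 0)` an EASY shape (`ℓ = (2sm+1)(t+1) - 1`), whenever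
`W ≥ 2Lm + sm + (2sm+1)t` and `N + m ≤ Lm + 1 + K(s-1)m`.  Here, at `p_c(ℤ³)`: `u ≥ (6·(4s)²)⁻¹` for every `m` (annulus window at aspect `s`,
`le_real_boxCrossing_mul_criticalProbI`), `e ≥ 85⁻³/(3·9³)` with `t = 3L` (easy brick `1:3`, `le_boxCrossProb_of_brick`), the scale is
`m = ⌊n/D⌋`, `D = 2L + s + 2st + t`, the chain length `2KD + 1` for the hard shape `(Kn, n, n)`, and small sides `n < D` are crossed by a
straight open segment (`pow_le_real_boxCross`, `p_c > 0`): one constant `c = min(q²e₀(t+1)⁻²·q^{2D}, p_c^D)`, `q = min(ϰ,1)·u₀`.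

References: D. Basu, A. Sapozhnikov, Electron. Commun. Probab. 22 (2017) no. 26, §1 (A2) and Thm. 1.1 [BasuSapozhnikov2017ECP];
H. Kesten, *Percolation Theory for Mathematicians* (1982), §3.3 Comment (v), Thm. 5.1 [Kesten1982]; G. Grimmett, *Percolation*
(1999), §11.7 [GrimmettPercolation1999]; C. Borgs, J. Chayes, H. Kesten, J. Spencer, Random Structures Algorithms 15 (1999)
§1 [BorgsChayesKestenSpencer1999]. [folklore]
-/

noncomputable section

namespace Summit.CriticalPhenomena.PercolationContinuityZ3.Theorems

namespace Rsw3

open MeasureTheory Literature.Probability.LatticeModels Literature.Probability.Percolation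
open SurfaceTension Crossing SimpleGraph

/-! ## At `p_c(ℤ³)`: (A2)□ ⇒ geometric hard-crossing lower bounds -/

/-- **(A2)□ AT `p_c(ℤ³)` IMPLIES THE LOWER HALF OF 3-D RSW WITH GEOMETRIC CONSTANTS.**  If Basu–Sapozhnikov's set-to-set
quasi-multiplicativity holds at `p_c(ℤ³)` at some aspect `(s, L)`, `2 ≤ s ≤ L`, with a constant `ϰ > 0`
(`Crossing.SetToSetQuasiMultAspectAt 3 p_c s L ϰ`), then `Crossing.GeometricHardCrossingLowerBound`: one `c > 0` with
`c^K ≤ P_{p_c}(boxCross (hardShape K n) 0)` for all `K, n ≥ 1`.  Constants: `t = 3L`, `D = 2L + s + 2st + t`, scale `m = ⌊n/D⌋`, chain length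
`2KD + 1`, `u₀ = (6·(4s)²)⁻¹` (annulus window at aspect `s`, `le_real_boxCrossing_mul_criticalProbI`), `e₀ = 85⁻³/(3·9³)` (easy brick `1:3`,
`le_boxCrossProb_of_brick`); small sides `n < D` by a straight open segment (`pow_le_real_boxCross`).  `θ(p_c) = 0` is not used.
[cite: BasuSapozhnikov2017ECP, §1 assumption (A2) and Thm. 1.1] [cite: Kesten1982, §3.3 Comment (v) and Thm. 5.1] -/
theorem geometricHardCrossingLowerBound_of_setToSetQuasiMultAspectAt {s L : ℕ} (hs : 2 ≤ s) (hsL : s ≤ L) {ϰ : ℝ}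
    (hϰ : 0 < ϰ) (h : SetToSetQuasiMultAspectAt 3 (criticalProbI 3) s L ϰ) : GeometricHardCrossingLowerBound := by
  classical
  set pc : unitInterval := criticalProbI 3 with hpc
  have hpc0 : (0 : ℝ) < pc := by rw [hpc, coe_criticalProbI]; exact criticalProb_zd_pos 3 (by norm_num)
  have hpc1 : (pc : ℝ) ≤ 1 := pc.2.2
  -- WLOG `ϰ ≤ 1`
  set ϰ₁ : ℝ := min ϰ 1 with hϰ₁
  have hϰ₁0 : 0 < ϰ₁ := lt_min hϰ one_pos
  have hϰ₁1 : ϰ₁ ≤ 1 := min_le_right _ _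
  have h₁ : SetToSetQuasiMultAspectAt 3 pc s L ϰ₁ := setToSetQuasiMultAspectAt_of_le (min_le_left _ _) h
  -- shape constants
  set t : ℕ := 3 * L with ht
  set D : ℕ := 2 * L + s + 2 * s * t + t with hD
  have hL2 : 2 ≤ L := le_trans hs hsL
  have hD1 : 1 ≤ D := by omega
  -- the annulus window at aspect `s`
  set u₀ : ℝ := (2 * (3 : ℝ))⁻¹ * ((4 * (s : ℝ)) ^ (3 - 1))⁻¹ with hu₀
  have hu₀0 : 0 < u₀ := by positivity
  have hu₀1 : u₀ ≤ 1 := by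
    have hs' : (2 : ℝ) ≤ s := by exact_mod_cast hs
    have h1 : (1 : ℝ) ≤ (4 * (s : ℝ)) ^ (3 - 1) := one_le_pow₀ (by linarith)
    calc u₀ = (2 * (3 : ℝ))⁻¹ * ((4 * (s : ℝ)) ^ (3 - 1))⁻¹ := hu₀
      _ ≤ 1 * 1 := mul_le_mul (by norm_num) (inv_le_one_of_one_le₀ h1) (by positivity) zero_le_one
      _ = 1 := one_mul 1
  have hu : ∀ m : ℕ, 1 ≤ m → u₀ ≤ (bondPercolation (zdGraph 3) pc).real (boxCrossing 3 m (s * m)) := fun m hm =>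
    le_real_boxCrossing_mul_criticalProbI (d := 3) (by norm_num) (by omega) hm
  -- the easy brick `1 : 3`
  set e₀ : ℝ := ((85 : ℝ) ^ 3)⁻¹ / (3 * (4 * 1 + 5) ^ 3) with he₀
  have he₀0 : 0 < e₀ := by positivity
  have he₀1 : e₀ ≤ 1 := by rw [he₀]; norm_num
  have he : ∀ m : ℕ, 1 ≤ m → e₀ ≤ (bondPercolation (zdGraph 3) pc).real
      (boxCross ![(((L - s) * m + 1 : ℕ) : ℤ), ((2 * s * m + 1) * (t + 1) - 1 : ℕ), ((2 * s * m + 1) * (t + 1) - 1 : ℕ)] 0) := by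
    intro m hm
    have hwid : (1 + 2) * ((L - s) * m + 1) ≤ (2 * s * m + 1) * (t + 1) - 1 := by
      have h1 : (L - s) * m ≤ L * m := Nat.mul_le_mul_right m (Nat.sub_le L s)
      have h2 : 2 * (L * m) ≤ s * (L * m) := Nat.mul_le_mul_right _ hs
      have h3 : (2 * s * m + 1) * (t + 1) = 6 * (s * (L * m)) + 2 * (s * m) + 3 * L + 1 := by rw [ht]; ring
      omega
    have h' := le_boxCrossProb_of_brick (r := 1) (u := (L - s) * m + 1) (n := (L - s) * m + 1) le_rfl (by omega) (by omega) hwid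
    rw [Nat.cast_one] at h'
    exact h'
  -- the constant
  set q : ℝ := ϰ₁ * u₀ with hq
  have hq0 : 0 < q := mul_pos hϰ₁0 hu₀0
  have hq1 : q ≤ 1 := by
    calc q = ϰ₁ * u₀ := hq
      _ ≤ 1 * 1 := mul_le_mul hϰ₁1 hu₀1 hu₀0.le zero_le_one
      _ = 1 := one_mul 1
  have ht1 : (1 : ℝ) ≤ (t : ℝ) + 1 := by linarith [(Nat.cast_nonneg t : (0 : ℝ) ≤ t)]
  set A : ℝ := q ^ 2 * e₀ / ((t : ℝ) + 1) ^ 2 with hA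
  have hA0 : 0 < A := by positivity
  have hA1 : A ≤ 1 := by
    rw [hA, div_le_one (by positivity)]
    calc q ^ 2 * e₀ ≤ 1 * 1 := mul_le_mul (pow_le_one₀ hq0.le hq1) he₀1 he₀0.le zero_le_one
      _ = 1 := one_mul 1
      _ ≤ ((t : ℝ) + 1) ^ 2 := one_le_pow₀ ht1
  set B : ℝ := q ^ (2 * D) with hB
  have hB0 : 0 < B := by positivity
  have hmin0 : 0 ≤ min (A * B) ((pc : ℝ) ^ D) := le_min (mul_pos hA0 hB0).le (pow_pos hpc0 D).le
  refine ⟨min (A * B) ((pc : ℝ) ^ D), lt_min (mul_pos hA0 hB0) (pow_pos hpc0 D), fun K n hK hn => ?_⟩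
  have hshape : hardShape K n = ![((K * n : ℕ) : ℤ), n, n] := by
    simp only [hardShape]; push_cast; rfl
  by_cases hnD : n < D
  · -- small sides: a straight open segment of `K n ≤ K D` edges
    have hpos : ∀ i : Fin 3, 0 ≤ hardShape K n i := by
      rw [Fin.forall_fin_succ, Fin.forall_fin_two]
      simp only [Fin.succ_zero_eq_one, Fin.succ_one_eq_two, hardShape, Matrix.cons_val_zero, Matrix.cons_val_one,
        Matrix.head_cons, Matrix.cons_val_two, Matrix.tail_cons]
      exact ⟨by positivity, by positivity, by positivity⟩
    have hseg := pow_le_real_boxCross pc hpos 0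
    have h0 : (hardShape K n 0).toNat = K * n := by
      rw [hshape, Matrix.cons_val_zero, Int.toNat_natCast]
    rw [h0] at hseg
    calc (min (A * B) ((pc : ℝ) ^ D)) ^ K ≤ ((pc : ℝ) ^ D) ^ K := pow_le_pow_left₀ hmin0 (min_le_right _ _) K
      _ = (pc : ℝ) ^ (D * K) := by rw [pow_mul]
      _ ≤ (pc : ℝ) ^ (K * n) :=
          pow_le_pow_of_le_one hpc0.le hpc1 (by rw [mul_comm D K]; exact Nat.mul_le_mul_left K hnD.le)
      _ ≤ (bondPercolation (zdGraph 3) pc).real (boxCross (hardShape K n) 0) := hseg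
  · -- large sides: the engine at scale `m = ⌊n / D⌋`
    push Not at hnD
    set m : ℕ := n / D with hm
    have hm1 : 1 ≤ m := Nat.div_pos hnD (by omega)
    have hDm : D * m ≤ n := by rw [hm, mul_comm]; exact Nat.div_mul_le_self n D
    have hnlt : n < D * m + D := by rw [hm, mul_comm]; exact Nat.lt_div_mul_add (by omega)
    set K' : ℕ := 2 * K * D + 1 with hK'
    have hW : 2 * L * m + s * m + (2 * s * m + 1) * t ≤ n := by
      have h1 : D * m = 2 * L * m + s * m + 2 * s * t * m + t * m := by rw [hD]; ring
      have h2 : t ≤ t * m := Nat.le_mul_of_pos_right t hm1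
      have h3 : (2 * s * m + 1) * t = 2 * s * t * m + t := by ring
      omega
    have hKc : K * n + m ≤ L * m + 1 + K' * ((s - 1) * m) := by
      have h1 : m ≤ (s - 1) * m := Nat.le_mul_of_pos_left m (by omega)
      have h2 : K * n ≤ K * (D * m + D) := Nat.mul_le_mul_left K hnlt.le
      have h3 : K * D ≤ K * D * m := Nat.le_mul_of_pos_right _ hm1
      have h4 : K' * m ≤ K' * ((s - 1) * m) := Nat.mul_le_mul_left K' h1
      have h5 : K' * m = 2 * (K * D * m) + m := by rw [hK']; ring
      have h6 : K * (D * m + D) = K * D * m + K * D := by ring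
      omega
    have hN1 : 1 ≤ K * n := Nat.one_le_iff_ne_zero.2 (Nat.mul_ne_zero (by omega) (by omega))
    have heng := pow_mul_div_le_real_boxCross_of_setToSetQuasiMultAspectAt h₁ hϰ₁0.le hs hsL hm1 t K' hN1 hW hKc
    rw [hshape]
    have hpow : q ^ (K' + 1) ≤ (ϰ₁ * (bondPercolation (zdGraph 3) pc).real (boxCrossing 3 m (s * m))) ^ (K' + 1) :=
      pow_le_pow_left₀ hq0.le (mul_le_mul_of_nonneg_left (hu m hm1) hϰ₁0.le) _
    calc (min (A * B) ((pc : ℝ) ^ D)) ^ K ≤ (A * B) ^ K := pow_le_pow_left₀ hmin0 (min_le_left _ _) K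
      _ = A ^ K * B ^ K := mul_pow A B K
      _ ≤ A * B ^ K := mul_le_mul_of_nonneg_right (pow_le_of_le_one hA0.le hA1 (by omega)) (by positivity)
      _ = q ^ (K' + 1) * e₀ / ((t : ℝ) + 1) ^ 2 := by
          rw [hA, hB, hK', ← pow_mul]; ring
      _ ≤ (ϰ₁ * (bondPercolation (zdGraph 3) pc).real (boxCrossing 3 m (s * m))) ^ (K' + 1) *
            (bondPercolation (zdGraph 3) pc).real
              (boxCross ![(((L - s) * m + 1 : ℕ) : ℤ), ((2 * s * m + 1) * (t + 1) - 1 : ℕ),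
                ((2 * s * m + 1) * (t + 1) - 1 : ℕ)] 0) / ((t : ℝ) + 1) ^ 2 := by
          refine div_le_div_of_nonneg_right ?_ (by positivity)
          exact mul_le_mul hpow (he m hm1) he₀0.le (pow_nonneg (mul_nonneg hϰ₁0.le measureReal_nonneg) _)
      _ ≤ (bondPercolation (zdGraph 3) pc).real (boxCross ![((K * n : ℕ) : ℤ), n, n] 0) := heng

/-- **(A2)□ at `p_c(ℤ³)` ⇒ `HardCrossingLowerBound k` for every `k ≥ 1`** (the boxes `{0..kn} × {0..n}²` are crossed the long way with
probability bounded below uniformly in `n`). [cite: BasuSapozhnikov2017ECP, §1 assumption (A2)] [cite: Kesten1982, §3.3 Comment (v)] -/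
theorem hardCrossingLowerBound_of_setToSetQuasiMultAspectAt {s L : ℕ} (hs : 2 ≤ s) (hsL : s ≤ L) {ϰ : ℝ} (hϰ : 0 < ϰ)
    (h : SetToSetQuasiMultAspectAt 3 (criticalProbI 3) s L ϰ) {k : ℕ} (hk : 1 ≤ k) : HardCrossingLowerBound k :=
  hardCrossingLowerBound_of_geometricHardCrossingLowerBound
    (geometricHardCrossingLowerBound_of_setToSetQuasiMultAspectAt hs hsL hϰ h) hk

/-- The cube is `hardShape 1`. [cite: Kesten1982, §3.3 (3.28)] -/
theorem hardShape_one (n : ℕ) : hardShape 1 n = cubeShape n := by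
  simp only [hardShape, cubeShape, Nat.cast_one, one_mul]

/-- **(A2)□ at `p_c(ℤ³)` ⇒ the uniform CUBE crossing** `CrossingLowerBound cubeShape 0` (the lower half of the hyperscaling postulate
`CubeCrossingNondegenerate`). [cite: BasuSapozhnikov2017ECP, §1 assumption (A2)] [cite: BorgsChayesKestenSpencer1999, §1 (postulates)] -/
theorem crossingLowerBound_cubeShape_of_setToSetQuasiMultAspectAt {s L : ℕ} (hs : 2 ≤ s) (hsL : s ≤ L) {ϰ : ℝ} (hϰ : 0 < ϰ)
    (h : SetToSetQuasiMultAspectAt 3 (criticalProbI 3) s L ϰ) : CrossingLowerBound cubeShape 0 := by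
  obtain ⟨c, hc, hcn⟩ := hardCrossingLowerBound_of_setToSetQuasiMultAspectAt hs hsL hϰ h (le_refl 1)
  exact ⟨c, hc, fun n hn => by rw [← hardShape_one]; exact hcn n hn⟩

/-- **Printed aspect `(2,4)`: `Crossing.SetToSetQuasiMult → Crossing.GeometricHardCrossingLowerBound`** — Basu–Sapozhnikov's (A2) at
`p_c(ℤ³)` (box form), the single open input of the printed IIC construction for `ℤ³`, implies the lower half of 3-D RSW with geometric
constants (equivalently a linear tube correlation length, `sup_n n·μ_{p_c}(n) < ∞`, by the lead's `rate_bounded_iff_exp_hardCrossing`).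
[cite: BasuSapozhnikov2017ECP, §1 assumption (A2) and Thm. 1.1] -/
theorem geometricHardCrossingLowerBound_of_setToSetQuasiMult (h : SetToSetQuasiMult) : GeometricHardCrossingLowerBound := by
  obtain ⟨ϰ, hϰ, h⟩ := h
  exact geometricHardCrossingLowerBound_of_setToSetQuasiMultAspectAt (s := 2) (L := 4) (by norm_num) (by norm_num) hϰ
    (setToSetQuasiMultAt_iff_aspect.1 h)

/-- `Crossing.SetToSetQuasiMult → Crossing.HardCrossingLowerBound k` (`k ≥ 1`). [cite: BasuSapozhnikov2017ECP, §1 assumption (A2)] -/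
theorem hardCrossingLowerBound_of_setToSetQuasiMult (h : SetToSetQuasiMult) {k : ℕ} (hk : 1 ≤ k) : HardCrossingLowerBound k :=
  hardCrossingLowerBound_of_geometricHardCrossingLowerBound (geometricHardCrossingLowerBound_of_setToSetQuasiMult h) hk

/-- `Crossing.SetToSetQuasiMult → Crossing.CrossingLowerBound cubeShape 0` (uniform cube crossings at `p_c(ℤ³)`).
[cite: BasuSapozhnikov2017ECP, §1 assumption (A2)] [cite: BorgsChayesKestenSpencer1999, §1 (postulates)] -/
theorem crossingLowerBound_cubeShape_of_setToSetQuasiMult (h : SetToSetQuasiMult) : CrossingLowerBound cubeShape 0 := by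
  obtain ⟨ϰ, hϰ, h⟩ := h
  exact crossingLowerBound_cubeShape_of_setToSetQuasiMultAspectAt (s := 2) (L := 4) (by norm_num) (by norm_num) hϰ
    (setToSetQuasiMultAt_iff_aspect.1 h)

/-- **Contrapositive, for the census column**: if the long-way crossing probability of some hard shape `{0..kn} × {0..n}²` (`k ≥ 1`) is NOT
bounded below at `p_c(ℤ³)`, then Basu–Sapozhnikov's (A2) fails at `p_c(ℤ³)` (box form, every constant).
[cite: BasuSapozhnikov2017ECP, §1 assumption (A2)] -/
theorem not_setToSetQuasiMult_of_not_hardCrossingLowerBound {k : ℕ} (hk : 1 ≤ k) (hno : ¬ HardCrossingLowerBound k) :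
    ¬ SetToSetQuasiMult := fun h => hno (hardCrossingLowerBound_of_setToSetQuasiMult h hk)

end Rsw3

end Summit.CriticalPhenomena.PercolationContinuityZ3.Theorems
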